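import Mathlib
import Literature.Analysis.FluidPDE.SawtoothCascade

/-!
# K2 lane — the AGE LAW in «control» form: a kernel-checked LYAPUNOV / POSITIVE-SYSTEM REDUCTION of `DebrisTransfer` at every age

planner ad-ideate-p4 g21 «control» (K2-lane service seat), crux workfile on the dir of stmt-AnomalousDissipation-19491 (route-2
`SawtoothPulseCascade`, Target stmt-AnomalousDissipation-20024, registry S4 v7.1 `K2AssemblyS4.lean` UNTOUCHED).  Arbiter A28-13 (4) names the
K2-lane analytic target after B1: **(B2) the age-law lemma `∀ k ≥ 1, DebrisTransfer α β θ K k t s t′ s′ (D̄)`** («debris of debris does not grow»,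
p4 g20's measured truth `K2DebrisAgeLaw-p4g20.md`: `D_k` non-increasing from `k = 1`, plateau `+ c·4^{-k}`); prover ad-k1loc-p2 g14 proves it BY
NAME with a geometric allowance (`K2DebrisAgeLaw.lean` v4 = structure theorem #6 text of record, A28-20: `DebrisTransfer α β θ K k V s H s′
(2100·D_V(θ,s)·12^k)`, Hölder pair `(3/8, 5/8)`, booked rate `12 ≤ 13.0` = what the v7.2 cone witness affords at the typed `ρc = 268/5`
(F-p4g21-1 / A28-19; v1–v3 had rate 21); mechanism: freezing; constants truth-sized, no cap).  THIS FILE is the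
mechanism-agnostic half: over p4's VERBATIM typed model (§0 = `K2AssemblyS4.lean` §0.1–§0.7, copied because `Cruxes/…` files are not importable)
it proves, sorry-free,

* §1 `debrisOut_le_of_lyapunov` — the REDUCTION.  Data: a class `P ℓ α β ζ` of (level, class, state) FORWARD-INVARIANT under the debris step
  `ζ ↦ (phasePieces α′ β′ θ K (child pm pn ζ)).debris` (child class `α′ = (α+pm)/2`, `β′ = (β+pn)/2`, level `ℓ+1`), a functional `W ℓ α β ζ`, a
  one-step GAIN `g ℓ ≥ 0` with `Σ_{pm,pn ∈ {0,1}} W (ℓ+1) α′ β′ (debris child) ≤ g ℓ · W ℓ α β ζ` on `P`, and an OUTPUT law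
  `debrisOut θ K t′ s′ 0 ℓ α β ζ ≤ C ℓ · W ℓ α β ζ` on `P` with `C ≥ 0`.  Conclusion: on `P`,
  `debrisOut θ K t′ s′ k ℓ α β ζ ≤ C (ℓ+k) · (∏_{j<k} g (ℓ+j)) · W ℓ α β ζ` for EVERY age `k` (induction on `k` generalising the level; the
  successor case is the definitional unfolding of `debrisOut (k+1)`).
* §2 `debrisOut_le_of_lyapunov_rate` (constant gain `g ≡ r²`, constant `C`: `≤ C·(r²)^k·W`) and `debrisOut_le_of_lyapunov_contract` (`r = 1`:
  `≤ C·W`, age-uniform — the «control» form: `W` is a LYAPUNOV functional of the debris dynamics on the reachable class `P`).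
* §3 `debrisTransfer_of_lyapunov_rate` / `debrisTransfer_of_lyapunov` — SEEDING: if every `W`-windowed input `(t, s)` of class `(α, β)` has its
  four first-generation debris children in `P` (level 1) with `Σ_c W 1 α_c β_c (𝒟_c ζ_in) ≤ B · cEnergy α β 0 K ζ_in`, then
  `∀ k ≥ 1, DebrisTransfer α β θ K k t s t′ s′ (√(C·B)·r^(k-1))`, resp. `(√(C·B))` at `r = 1` — the typed (B2) conclusion with ONE age-free
  constant.  The seeding constant `B` is where the Orr-type first-step amplification lives (measured `≤ 16×` in energy, input sheets → age-1
  debris); the Lyapunov law starts at age 1, exactly as the data say.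
* §4 `debrisOut_le_of_lyapunovVec` — the POSITIVE-LINEAR-SYSTEM form (vector Lyapunov function `W⃗ : … → Fin m → ℝ`, entrywise-nonnegative
  gain matrix `A`, output row `c⃗ ≥ 0`): `Σ_children W⃗(child) ≤ A·W⃗(ζ)` componentwise on `P` and `debrisOut₀ ≤ c⃗ ⬝ W⃗` give
  `debrisOut k ≤ c⃗ ⬝ (A^k)·W⃗(ζ)`; this hosts two-quantity laws such as p2's (energy, enstrophy) freezing law without first scalarising them, and
  makes the cone condition readable as «`√(spectral radius of A) < ρc`».
* §6 `genW`, `debrisOut_le_genW`, `genW_succ_le_of_oneStepLaw`, `debrisTransfer_of_genFlat` — the AGGREGATE («generation») form: the probe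
  (kit j333310 / j333493, K = 48 / 96 / 192, ages ≤ 3, 42 class × cell cases) shows the level energy is NOT a node-wise Lyapunov functional on
  the reachable states (genuine K-independent gains 1.03–1.10 on energetic nodes at ages 0–1, ×4.8 for top-probed-shell H inputs, and ×1.5–6 on
  energetically negligible nodes), node-wise ENSTROPHY is (ratio ≤ 1.0000 everywhere; p2 proves it), and the TOTAL energy of a debris
  generation is non-increasing from parent age 2 on in every case at every K (`sup = 0.9998`) after a first-generation transient (≤ ×2.4,
  H inputs, growing with the input shell; ≤ ×1.09 for V inputs).  `genW W k` = Σ of `W` over the depth-`k` generation; a node-wise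
  output law still gives `debrisOut k ≤ C·genW W k`; FLATNESS `genW W k ≤ Λ·genW W k₀ (k ≥ k₀)` + depth-`k₀` seeding `B` ⇒
  `∀ k ≥ k₀, DebrisTransfer … (√(C·Λ·B))` — the younger ages are booked by their own (certified) entries.  §1–§2 are the case where flatness is
  proved node by node (`genW_succ_le_of_oneStepLaw`).

HOW IT IS MEANT TO BE USED.  p2's tree law `debrisOut_H_le` (`K2CreationLaws.lean` §25) IS §2 with `P` = windowed states of classes `β ∈ [0,1)`,
`W = cEnergy`, `g ≡ (θ²+2)²` (`cEnergy_debris_le` ∘ `sum_cEnergy_child_le`), `C ≡ (θ²+2)·16000(π+1)`; the freezing law of record (p2 v4) is §2 with `r = 12` on V-source rows — and §4 in its un-scalarised `(E, Ens)` form; the measured truth (no growth) is §2-contract with `W` = level energy restricted to the REACHABLE class (content that has passed ≥ 1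
debris phase) — the one-step hypothesis `Σ_c E(𝒟_c η) ≤ E(η)` for reachable `η` is the «restricted contraction» probed numerically in the companion
memo `K2AgeLawControl-p4g21.md` (it is FALSE on raw input sheets: Orr-type transient growth, hence the seeding split).  Summable level displacements
(`g ℓ = 1 + ε_ℓ`, `Π(1+ε_ℓ) < ∞`) ride in §1's product.
WHAT THIS IS NOT: no one-step law is proved here (that is p2's (F1)/(F2)); no entry of `BookV7` is certified; nothing discharges `stub_S3_cone` /
`stub_S2_matRep`; 19491 / 20024 open; AD not claimed.
-/

set_option linter.dupNamespace false
set_option linter.unusedVariables false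

noncomputable section

namespace Summit.AnomalousDissipation.AnomalousDissipation.Cruxes.K1LocalisedCascade.K2AgeLawControl

open Complex MeasureTheory intervalIntegral Finset
open Literature.Analysis.FluidPDE.SawtoothCascade

/-! ## 0. The one-family objects of `K2TypedSlotMap.lean` (g15, commit 5cbecd5f08b7), reproduced (kernel sign as fixed by p2)

(`Cruxes/…` workfiles are not importable modules on the farm — `lean check` reports the import as unbuilt — so §1–§3 of
that file are copied here unchanged except for the ONE-CHARACTER kernel sign fix of p2's `K2SlotMapIdentities.lean` (see
`lineKernel`); the names agree, the namespace differs.) -/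

section SlotMapCopy

/-! ### 0.1 Kernel, transport phase, Kelvin–Helmholtz block, explicit propagator -/

/-- The periodised Biot–Savart LINE KERNEL of the family with streamwise wavenumber `a` and transverse Bloch
phase `β`: `G_{a,β}(y) = Σ_{n∈ℤ} e^{2πiβn} g(y - n)`, `g(y) = -e^{-κ|y|}/(2κ)`, `κ = 2π|a|`, in closed form on
`y = ⌊y⌋ + r`: `e^{2πiβ⌊y⌋} · (-(e^{-κr}/(1 - e^{-2πiβ}e^{-κ}) + e^{κ(r-1)} e^{2πiβ}/(1 - e^{2πiβ}e^{-κ}))/(2κ))`.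
(`-G_{a,β}(y₀ - y)` is the stream function at height `y₀` of the unit vorticity mode `e^{2πiax} δ(· - y)`;
junk at `a = 0`, where it is only ever multiplied by `a`.)  SIGN: this is p2's CORRECTED term (`K2SlotMapIdentities.lean`, prover
ad-k1loc-p2 g9: in g15's file the leading `-` bound only the first lattice branch; with the bracket fixed `KernelAtZero`/`KernelAtHalf`/
`BlockSq`/`PropagatorODE` are proved there from tree theorems p684501/p684727).  The kit engines of this memo (`Gfun` of `wo_p4_k2_4.py`,
g15's 3h engine) compute `-s/(2κ)` with `s` = the SUM of both branches, i.e. the corrected sign, so no number is affected. -/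
def lineKernel (a β y : ℝ) : ℂ :=
  let κ : ℝ := 2 * Real.pi * |a|
  let r : ℝ := y - (⌊y⌋ : ℝ)
  let z : ℂ := Complex.exp (2 * Real.pi * β * Complex.I)
  Complex.exp (2 * Real.pi * β * (⌊y⌋ : ℝ) * Complex.I) *
    ((-(((Real.exp (-(κ * r)) : ℂ) / (1 - (starRingEnd ℂ z) * (Real.exp (-κ) : ℂ)))
          + (Real.exp (κ * (r - 1)) : ℂ) * z / (1 - z * (Real.exp (-κ) : ℂ)))) / (2 * κ : ℂ))

/-- Transport multiplier of an H slot of total strain `θ` on the streamwise mode `a`: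
`e^{2πiax} ζ₀(y) ↦ e^{2πia(x - θ·triWave y)} ζ₀(y)`. -/
def transportPhase (a θ y : ℝ) : ℂ :=
  Complex.exp (-(2 * Real.pi * a * θ * triWave y : ℝ) * Complex.I)

/-- The 2 × 2 Kelvin–Helmholtz block of the kink-sheet pair `(q₊ on y = 1/4, q₋ on y = -1/4)`:
`X = 2πia · [[-1/4 - 2G(0), -2G(1/2)], [2 conj G(1/2), 1/4 + 2G(0)]]`, `G = lineKernel a β`
(diagonal = transport of each sheet by the shear at its own line ± self/partner induction; the tree's
`khField k β` is `X` with `2πG(0) = Σ₀`, `2π conj G(1/2) = S`). -/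
def blockX (a β : ℝ) : Matrix (Fin 2) (Fin 2) ℂ :=
  ((2 * Real.pi * a : ℝ) * Complex.I : ℂ) •
    !![-(1 / 4 : ℂ) - 2 * lineKernel a β 0, -2 * lineKernel a β (1 / 2);
       2 * starRingEnd ℂ (lineKernel a β (1 / 2)), (1 / 4 : ℂ) + 2 * lineKernel a β 0]

/-- `λ(a, β) = -a²·c²(a, β)`: the common eigenvalue-square of the block, `X² = λ • 1` (`BlockSq`);
`λ > 0` unstable (rate `√λ = sawSigma a β`), `λ < 0` stable, `λ = 0` neutral. -/
def khLam (a β : ℝ) : ℝ := -(a ^ 2 * sawC2 a β)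

/-- `C(t)`: `cosh(√λ t)` / `cos(√(-λ) t)` / `1`. -/
def propC (a β t : ℝ) : ℝ :=
  if 0 < khLam a β then Real.cosh (Real.sqrt (khLam a β) * t)
  else if khLam a β < 0 then Real.cos (Real.sqrt (-(khLam a β)) * t) else 1

/-- `Sn(t)`: `sinh(√λ t)/√λ` / `sin(√(-λ) t)/√(-λ)` / `t`. -/
def propSn (a β t : ℝ) : ℝ :=
  if 0 < khLam a β then Real.sinh (Real.sqrt (khLam a β) * t) / Real.sqrt (khLam a β)
  else if khLam a β < 0 then Real.sin (Real.sqrt (-(khLam a β)) * t) / Real.sqrt (-(khLam a β)) else t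

/-- The explicit propagator `P(t) = e^{tX} = C(t)·1 + Sn(t)·X` (p2 `sheet_solution_eq`; `det P = 1`). -/
def propagator (a β t : ℝ) : Matrix (Fin 2) (Fin 2) ℂ :=
  ((propC a β t : ℝ) : ℂ) • (1 : Matrix (Fin 2) (Fin 2) ℂ) + ((propSn a β t : ℝ) : ℂ) • blockX a β

/-! ### 0.2 Lamination states, forcing, Duhamel, the slot map -/

/-- S-4 state of ONE line family: an interior density profile on the period `[-1/2, 1/2)` (quasi-periodic
continuation with Bloch phase `β` understood) plus finitely many vortex SHEETS `(position yᵢ ∈ [-1/2,1/2),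
amplitude cᵢ)`, i.e. the transverse density `ζ₀(y) + Σᵢ cᵢ δ(y - yᵢ)` of the streamwise mode `e^{2πiax}`. -/
structure LamState where
  interior : ℝ → ℂ
  sheets : List (ℝ × ℂ)

/-- The pure interior mode `ζ₀ ≡ 1` (the transverse mode `n = 0` when `β = 0`): the comb remnant of P3. -/
def pureMode : LamState := ⟨fun _ => 1, []⟩

/-- A bare sheet pair on the kink lines with amplitudes `(q₊, q₋)` and no interior content. -/
def sheetPair (qp qm : ℂ) : LamState := ⟨fun _ => 0, [((1 / 4 : ℝ), qp), (-(1 / 4 : ℝ), qm)]⟩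

/-- Forcing of the block at slot-time `s`: `f(s) = 2πia · (-2 ∫ G(1/4 - y) dμ_s(y), 2 ∫ G(-1/4 - y) dμ_s(y))`
where `μ_s = transported state = (ζ₀(y) dy + Σ cᵢ δ_{yᵢ}) · e^{-2πias·triWave y}` — the transverse velocity the
transported content induces on the two kink lines, times the vorticity jump. -/
def forcing (a β : ℝ) (st : LamState) (s : ℝ) : Fin 2 → ℂ :=
  let src : ℝ → ℂ := fun y0 =>
    (∫ y in (-(1 / 2 : ℝ))..(1 / 2), lineKernel a β (y0 - y) * st.interior y * transportPhase a s y)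
      + (st.sheets.map (fun p => lineKernel a β (y0 - p.1) * p.2 * transportPhase a s p.1)).sum
  ![((2 * Real.pi * a : ℝ) * Complex.I : ℂ) * (-2) * src (1 / 4),
    ((2 * Real.pi * a : ℝ) * Complex.I : ℂ) * 2 * src (-(1 / 4))]

/-- Fresh sheet amplitudes after strain `θ` (Duhamel): `q(θ) = ∫₀^θ P(θ - s) f(s) ds`. -/
def sheetAmps (a β θ : ℝ) (st : LamState) : Fin 2 → ℂ :=
  ∫ s in (0 : ℝ)..θ, (propagator a β (θ - s)).mulVec (forcing a β st s)

/-- THE SLOT MAP on one line family (S-2): transported interior, transported old sheets, plus the fresh pair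
`(1/4, q₊), (-1/4, q₋)`. -/
def slotMap (a β θ : ℝ) (st : LamState) : LamState :=
  ⟨fun y => st.interior y * transportPhase a θ y,
   (st.sheets.map (fun p => (p.1, p.2 * transportPhase a θ p.1)))
     ++ [((1 / 4 : ℝ), sheetAmps a β θ st 0), (-(1 / 4 : ℝ), sheetAmps a β θ st 1)]⟩

/-! ### 0.3 Fourier coefficients and energy -/

/-- Transverse Fourier coefficient at `β + n`: `ζ̂(n) = ∫ ζ₀ e^{-2πi(β+n)y} dy + Σᵢ cᵢ e^{-2πi(β+n)yᵢ}`. -/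
def coeff (β : ℝ) (st : LamState) (n : ℤ) : ℂ :=
  (∫ y in (-(1 / 2 : ℝ))..(1 / 2), st.interior y * Complex.exp (-(2 * Real.pi * (β + n) * y : ℝ) * Complex.I))
    + (st.sheets.map (fun p => p.2 * Complex.exp (-(2 * Real.pi * (β + n) * p.1 : ℝ) * Complex.I))).sum

/-- Kinetic energy (velocity `L²` norm squared, up to the common factor) of the state on the family `(a, β)`:
`E = Σ_n |ζ̂(n)|² / (4π² (a² + (β + n)²))` (junk 0 if not summable; summable whenever the interior is
integrable, the coefficients being bounded and the weights `O(n⁻²)`). -/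
def energy (a β : ℝ) (st : LamState) : ℝ :=
  ∑' n : ℤ, ‖coeff β st n‖ ^ 2 / (4 * Real.pi ^ 2 * (a ^ 2 + (β + n) ^ 2))


end SlotMapCopy

/-! ### 0.4 Truncated class states, energy, children -/

/-- Lattice state of one Bloch class `(α, β)`: the vorticity Fourier coefficient at wavevector `(α + m, β + n)`. -/
abbrev CState : Type := ℤ → ℤ → ℂ

/-- The truncation window `[-K, K]`. -/
def win (K : ℕ) : Finset ℤ := Finset.Icc (-(K : ℤ)) K

/-- Kinetic energy at level `ℓ` (wavenumbers scaled by `2^ℓ`) of the truncated state: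
`Σ_{|m|,|n| ≤ K} |ζ(m,n)|² / (4π² 4^ℓ ((α+m)² + (β+n)²))` (the zero mode, if present, contributes 0: `x / 0 = 0`). -/
def cEnergy (α β : ℝ) (ℓ K : ℕ) (ζ : CState) : ℝ :=
  ∑ m ∈ win K, ∑ n ∈ win K, ‖ζ m n‖ ^ 2 / (4 * Real.pi ^ 2 * (4 : ℝ) ^ ℓ * ((α + m) ^ 2 + (β + n) ^ 2))

/-- CHILDREN re-framing (one cascade level down, period halves): the modes of class `(α, β)` with parities `(pm, pn)`
form the child class `((α + pm)/2, (β + pn)/2)` with `ζ_child(m, n) = ζ(2m + pm, 2n + pn)`. -/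
def child (pm pn : ℤ) (ζ : CState) : CState := fun m n => ζ (2 * m + pm) (2 * n + pn)

/-- The child class of `(α, β)` with parities `(pm, pn)`. -/
def childClass (α β : ℝ) (pm pn : ℤ) : ℝ × ℝ := ((α + pm) / 2, (β + pn) / 2)

/-- The parity set `{0, 1}`. -/
def parities : Finset ℤ := {0, 1}

/-! ### 0.5 The two slots of a phase, family by family -/

/-- The transverse profile `y ↦ Σ_{|n| ≤ K} c(n) e^{2πi(β+n)y}` of a truncated coefficient row. -/
def modeProfile (β : ℝ) (K : ℕ) (c : ℤ → ℂ) : ℝ → ℂ :=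
  fun y => ∑ n ∈ win K, c n * Complex.exp ((2 * Real.pi * (β + n) * y : ℝ) * Complex.I)

/-- H slot (strain `θ`), TRANSPORTED part: row `m` is the family `(α + m, β)`; its profile is multiplied by
`transportPhase` and re-expanded (`K2SlotMap.coeff`), truncated to the window. -/
def hTransport (α β θ : ℝ) (K : ℕ) (ζ : CState) : CState := fun m n' =>
  if m ∈ win K ∧ n' ∈ win K then
    coeff β ⟨fun y => modeProfile β K (ζ m) y * transportPhase (α + m) θ y, []⟩ n'
  else 0

/-- H slot, FRESH H-pair densities per row (`K2SlotMap.sheetAmps` of the row's family): `q m = (q₊, q₋)` on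
`y = 1/4`, `y = -1/4`, streamwise wavenumber `α + m`. -/
def hFresh (α β θ : ℝ) (K : ℕ) (ζ : CState) : ℤ → Fin 2 → ℂ := fun m =>
  if m ∈ win K then sheetAmps (α + m) β θ ⟨modeProfile β K (ζ m), []⟩ else 0

/-- Lattice state of an H-sheet pair with densities `q` (engine `SH`): `Z(m,n) = q₊(m) e^{-iπ(β+n)/2} + q₋(m) e^{iπ(β+n)/2}`. -/
def hPairState (β : ℝ) (q : ℤ → Fin 2 → ℂ) : CState := fun m n =>
  q m 0 * Complex.exp (-(Real.pi * (β + n) / 2 : ℝ) * Complex.I)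
    + q m 1 * Complex.exp ((Real.pi * (β + n) / 2 : ℝ) * Complex.I)

/-- V slot (strain `θ`), TRANSPORTED part: column `n` is the family `(β + n, α)` (roles of the coordinates exchanged),
its profile over `x` read from the column. -/
def vTransport (α β θ : ℝ) (K : ℕ) (ζ : CState) : CState := fun m' n =>
  if m' ∈ win K ∧ n ∈ win K then
    coeff α ⟨fun x => modeProfile α K (fun m => ζ m n) x * transportPhase (β + n) θ x, []⟩ m'
  else 0

/-- V slot, FRESH V-pair densities per column: `p n = (p₊, p₋)` on `x = 1/4`, `x = -1/4`, streamwise wavenumber `β + n`. -/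
def vFresh (α β θ : ℝ) (K : ℕ) (ζ : CState) : ℤ → Fin 2 → ℂ := fun n =>
  if n ∈ win K then sheetAmps (β + n) α θ ⟨modeProfile α K (fun m => ζ m n), []⟩ else 0

/-- Lattice state of a V-sheet pair with densities `p` (engine `SV`): `Z(m,n) = p₊(n) e^{-iπ(α+m)/2} + p₋(n) e^{iπ(α+m)/2}`. -/
def vPairState (α : ℝ) (p : ℤ → Fin 2 → ℂ) : CState := fun m n =>
  p n 0 * Complex.exp (-(Real.pi * (α + m) / 2 : ℝ) * Complex.I)
    + p n 1 * Complex.exp ((Real.pi * (α + m) / 2 : ℝ) * Complex.I)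

/-! ### 0.6 Phase pieces (material bookkeeping of one phase = H slot then V slot at one level) -/

/-- The three pieces a phase produces from the state entering it. -/
structure PhasePieces where
  /-- densities of the fresh straight V-pair created in the V slot (type V). -/
  freshV : ℤ → Fin 2 → ℂ
  /-- densities of the fresh H-pair created in the H slot; at phase end its state is `vTransport (hPairState freshH)` (type H). -/
  freshH : ℤ → Fin 2 → ℂ
  /-- debris: the entering state transported by both slots. -/
  debris : CState

/-- The phase pieces of class `(α, β)` at truncation `K` (strain `θ` per slot): `T = hTransport ζ`, `hq = hFresh ζ`,
the V slot acts on `T + hPairState hq`; fresh V densities from the whole of it, debris = `vTransport T`. -/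
def phasePieces (α β θ : ℝ) (K : ℕ) (ζ : CState) : PhasePieces :=
  let T : CState := hTransport α β θ K ζ
  let hq : ℤ → Fin 2 → ℂ := hFresh α β θ K ζ
  let S : CState := fun m n => T m n + hPairState β hq m n
  ⟨vFresh α β θ K S, hq, vTransport α β θ K T⟩

/-- The total state at phase end: fresh V pair + V-transported fresh H pair + debris. -/
def phaseTotal (α β θ : ℝ) (K : ℕ) (ζ : CState) : CState := fun m n =>
  let pc := phasePieces α β θ K ζ
  vPairState α pc.freshV m n + vTransport α β θ K (hPairState β pc.freshH) m n + pc.debris m n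

/-! ### 0.7 Shells and the shell-transfer entries -/

/-- Lower edges of the shells of `|streamwise wavenumber|` of a sheet density: `S0 = [0, 0.64)` (KH band),
`S1 = [0.64, 2)`, `S(s) = [2^(s-1), 2^s)` for `s ≥ 2`. -/
def shellLo : ℕ → ℝ
  | 0 => 0
  | 1 => 16 / 25
  | (s + 2) => (2 : ℝ) ^ (s + 1)

/-- Upper edge of shell `s`. -/
def shellHi (s : ℕ) : ℝ := shellLo (s + 1)

/-- `x` lies in shell `s`. -/
def InShell (s : ℕ) (x : ℝ) : Prop := shellLo s ≤ |x| ∧ |x| < shellHi s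

/-- The two piece types carrying a shell profile: fresh straight V pairs and once-transported H pairs. -/
inductive PType
  | V
  | H
  deriving DecidableEq, Fintype

/-- Densities restricted to shell `s` (offset `c` = the class coordinate along the sheet). -/
def restrictShell (s : ℕ) (c : ℝ) (d : ℤ → Fin 2 → ℂ) : ℤ → Fin 2 → ℂ :=
  fun (k : ℤ) => if shellLo s ≤ |c + (k : ℝ)| ∧ |c + (k : ℝ)| < shellHi s then d k else 0

/-- "the densities `d` are supported in shell `s`". -/
def SupportedIn (s : ℕ) (c : ℝ) (d : ℤ → Fin 2 → ℂ) : Prop := ∀ k : ℤ, ¬ InShell s (c + (k : ℝ)) → d k = 0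

/-- v1.3: "the densities `d` are supported in shell `s` AND in the truncation window `|k| ≤ K`" (the engine's input basis). -/
def SupportedInW (s : ℕ) (c : ℝ) (K : ℕ) (d : ℤ → Fin 2 → ℂ) : Prop :=
  SupportedIn s c d ∧ ∀ k : ℤ, k ∉ win K → d k = 0

/-- v1.3: truncation of a class state to the window `|m|, |n| ≤ K` (the engine's `(2K+1)²` arrays). -/
def truncW (K : ℕ) (ζ : CState) : CState :=
  fun (m n : ℤ) => if m ∈ win K ∧ n ∈ win K then ζ m n else 0

/-- The lattice state, at phase ENTRY (class `(α, β)`, level 0), of an input piece of type `t` with densities `d`: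
a straight V pair (v1.3: window-truncated, as the engine's `SV` on the `(2K+1)²` lattice), resp. an H pair V-transported once
(created in the previous H slot of the same level; `vTransport` is windowed already). -/
def inputState (α β θ : ℝ) (K : ℕ) : PType → (ℤ → Fin 2 → ℂ) → CState
  | PType.V, p => truncW K (vPairState α p)
  | PType.H, q => vTransport α β θ K (hPairState β q)

/-- The class coordinate along the sheets of type `t`: `β` for V pairs (densities in `β + n`), `α` for H pairs. -/
def alongCoord (α β : ℝ) : PType → ℝ
  | PType.V => β
  | PType.H => α

/-- Level-`ℓ` energy of the output piece `(t', s')` among the phase pieces `pc` of a class `(α', β')` sitting at level `ℓ`. -/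
def outEnergyAt (α' β' θ : ℝ) (K ℓ : ℕ) (s' : ℕ) (pc : PhasePieces) : PType → ℝ
  | PType.V => cEnergy α' β' ℓ K (vPairState α' (restrictShell s' β' pc.freshV))
  | PType.H => cEnergy α' β' ℓ K (vTransport α' β' θ K (hPairState β' (restrictShell s' α' pc.freshH)))

/-- Level-1 energy of the output piece `(t', s')` among the phase pieces `pc` of the child class `(α', β')`. -/
def outEnergy (α' β' θ : ℝ) (K : ℕ) (s' : ℕ) (pc : PhasePieces) : PType → ℝ :=
  outEnergyAt α' β' θ K 1 s' pc

/-- SHELL-TRANSFER ENTRY `M[(t', s'), (t, s)] ≤ M` for the parent class `(α, β)` at truncation `K`: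
every input piece of type `t` with densities in shell `s` produces, summed over the four children and after their
phase, an output piece `(t', s')` of level-1 energy ≤ `M²` × its own level-0 energy.  (WO-p4-K2-4 computes the sup.) -/
def Transfer (α β θ : ℝ) (K : ℕ) (t : PType) (s : ℕ) (t' : PType) (s' : ℕ) (M : ℝ) : Prop :=
  ∀ d : ℤ → Fin 2 → ℂ, SupportedInW s (alongCoord α β t) K d →
    (∑ pm ∈ parities, ∑ pn ∈ parities,
        outEnergy ((α + pm) / 2) ((β + pn) / 2) θ K s'
          (phasePieces ((α + pm) / 2) ((β + pn) / 2) θ K (child pm pn (inputState α β θ K t d))) t')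
      ≤ M ^ 2 * cEnergy α β 0 K (inputState α β θ K t d)

/-- DEBRIS column `m_O[(t, s)] ≤ mO`: the twice-transported remainder produced from an input piece `(t, s)`. -/
def DebrisCreation (α β θ : ℝ) (K : ℕ) (t : PType) (s : ℕ) (mO : ℝ) : Prop :=
  ∀ d : ℤ → Fin 2 → ℂ, SupportedInW s (alongCoord α β t) K d →
    (∑ pm ∈ parities, ∑ pn ∈ parities,
        cEnergy ((α + pm) / 2) ((β + pn) / 2) 1 K
          (phasePieces ((α + pm) / 2) ((β + pn) / 2) θ K (child pm pn (inputState α β θ K t d))).debris)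
      ≤ mO ^ 2 * cEnergy α β 0 K (inputState α β θ K t d)

/-- DEBRIS LINEAGE OUTPUT.  `debrisOut θ K t' s' k ℓ α β ζ` = the energy, at level `ℓ + k + 1` and summed over all
`4^(k+1)` descendant classes, of the output piece `(t', s')` produced by content `ζ` of class `(α, β)` (level `ℓ`) that
travels the DEBRIS path (children ↦ transported by both slots) for `k` phases and then passes one full phase;
`k = 0` is the quantity bounded in `Transfer`.  (WO-p4-K2-4b, `wo_p4_k2_4b.py`, measures the sups for ages `k ≤ 3`.) -/
def debrisOut (θ : ℝ) (K : ℕ) (t' : PType) (s' : ℕ) : ℕ → ℕ → ℝ → ℝ → CState → ℝ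
  | 0, ℓ, α, β, ζ => ∑ pm ∈ parities, ∑ pn ∈ parities,
      outEnergyAt ((α + pm) / 2) ((β + pn) / 2) θ K (ℓ + 1) s'
        (phasePieces ((α + pm) / 2) ((β + pn) / 2) θ K (child pm pn ζ)) t'
  | (k + 1), ℓ, α, β, ζ => ∑ pm ∈ parities, ∑ pn ∈ parities,
      debrisOut θ K t' s' k (ℓ + 1) ((α + pm) / 2) ((β + pn) / 2)
        (phasePieces ((α + pm) / 2) ((β + pn) / 2) θ K (child pm pn ζ)).debris

/-- RENEWAL (DEBRIS-TRANSFER) ENTRY of age `k ≥ 1`: `D_k[(t', s'), (t, s)] ≤ D` for the parent class `(α, β)` —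
the age-`k` debris of an input piece `(t, s)` produces output pieces `(t', s')` of energy ≤ `D²` × the input energy.
No decay in `k` is asked for (the data show persistence, `O→O ≈ 1`, for KH-band debris): the renewal cone below only
needs the entries bounded, uniformly in the age. -/
def DebrisTransfer (α β θ : ℝ) (K k : ℕ) (t : PType) (s : ℕ) (t' : PType) (s' : ℕ) (D : ℝ) : Prop :=
  ∀ d : ℤ → Fin 2 → ℂ, SupportedInW s (alongCoord α β t) K d →
    debrisOut θ K t' s' k 0 α β (inputState α β θ K t d) ≤ D ^ 2 * cEnergy α β 0 K (inputState α β θ K t d)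


/-! ## 1. The Lyapunov reduction (level-dependent gain and output constant) -/

section Reduction

variable (θ : ℝ) (K : ℕ) (t' : PType) (s' : ℕ)

/-- The debris child of `ζ` (class `(α, β)`) with parities `(pm, pn)`: the both-slots-transported remainder of the child class. -/
def debrisChild (α β : ℝ) (pm pn : ℤ) (ζ : CState) : CState :=
  (phasePieces ((α + pm) / 2) ((β + pn) / 2) θ K (child pm pn ζ)).debris

/-- Forward invariance of a class `P` of (level, class, state) under the debris step. -/
def DebrisInvariant (P : ℕ → ℝ → ℝ → CState → Prop) : Prop :=
  ∀ ℓ α β ζ, P ℓ α β ζ → ∀ pm ∈ parities, ∀ pn ∈ parities,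
    P (ℓ + 1) ((α + pm) / 2) ((β + pn) / 2) (debrisChild θ K α β pm pn ζ)

/-- One-step law of a functional `W` with gain `g ℓ` on `P`: the children's total `W` after one debris step is at most `g ℓ ×` the parent's. -/
def OneStepLaw (P : ℕ → ℝ → ℝ → CState → Prop) (W : ℕ → ℝ → ℝ → CState → ℝ) (g : ℕ → ℝ) : Prop :=
  ∀ ℓ α β ζ, P ℓ α β ζ →
    (∑ pm ∈ parities, ∑ pn ∈ parities, W (ℓ + 1) ((α + pm) / 2) ((β + pn) / 2) (debrisChild θ K α β pm pn ζ)) ≤ g ℓ * W ℓ α β ζ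

/-- Output law on `P`: one full phase of the children of `ζ` produces `(t′, s′)`-output of energy at most `C ℓ × W`. -/
def OutputLaw (P : ℕ → ℝ → ℝ → CState → Prop) (W : ℕ → ℝ → ℝ → CState → ℝ) (C : ℕ → ℝ) : Prop :=
  ∀ ℓ α β ζ, P ℓ α β ζ → debrisOut θ K t' s' 0 ℓ α β ζ ≤ C ℓ * W ℓ α β ζ

/-- **THE REDUCTION.**  Forward-invariant class + one-step law with gains `g ≥ 0` + output law with `C ≥ 0` ⇒ the debris lineage output of
every age is controlled by `W` at the root: `debrisOut k ℓ ζ ≤ C (ℓ+k) · ∏_{j<k} g (ℓ+j) · W ℓ ζ`. -/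
theorem debrisOut_le_of_lyapunov (P : ℕ → ℝ → ℝ → CState → Prop) (W : ℕ → ℝ → ℝ → CState → ℝ) (g C : ℕ → ℝ)
    (hg : ∀ ℓ, 0 ≤ g ℓ) (hC : ∀ ℓ, 0 ≤ C ℓ)
    (hP : DebrisInvariant θ K P) (hW : OneStepLaw θ K P W g) (hOut : OutputLaw θ K t' s' P W C) :
    ∀ (k ℓ : ℕ) (α β : ℝ) (ζ : CState), P ℓ α β ζ →
      debrisOut θ K t' s' k ℓ α β ζ ≤ C (ℓ + k) * (∏ j ∈ Finset.range k, g (ℓ + j)) * W ℓ α β ζ := by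
  intro k
  induction k with
  | zero =>
    intro ℓ α β ζ hζ
    simpa using hOut ℓ α β ζ hζ
  | succ k ih =>
    intro ℓ α β ζ hζ
    -- the successor age unfolds definitionally into the sum over the four debris children, one level down
    have hunfold : debrisOut θ K t' s' (k + 1) ℓ α β ζ =
        ∑ pm ∈ parities, ∑ pn ∈ parities, debrisOut θ K t' s' k (ℓ + 1) ((α + pm) / 2) ((β + pn) / 2) (debrisChild θ K α β pm pn ζ) := by
      simp only [debrisOut, debrisChild]
    -- the common factor one level down
    set F : ℝ := C (ℓ + 1 + k) * ∏ j ∈ Finset.range k, g (ℓ + 1 + j) with hF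
    have hF0 : 0 ≤ F := mul_nonneg (hC _) (Finset.prod_nonneg fun j _ => hg _)
    have hchild : ∀ pm ∈ parities, ∀ pn ∈ parities,
        debrisOut θ K t' s' k (ℓ + 1) ((α + pm) / 2) ((β + pn) / 2) (debrisChild θ K α β pm pn ζ) ≤
          F * W (ℓ + 1) ((α + pm) / 2) ((β + pn) / 2) (debrisChild θ K α β pm pn ζ) := by
      intro pm hpm pn hpn
      exact ih (ℓ + 1) _ _ _ (hP ℓ α β ζ hζ pm hpm pn hpn)
    have hprod : C (ℓ + (k + 1)) * ∏ j ∈ Finset.range (k + 1), g (ℓ + j) = F * g ℓ := by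
      have e1 : C (ℓ + (k + 1)) = C (ℓ + 1 + k) := by
        congr 1
        omega
      have e2 : ∏ j ∈ Finset.range (k + 1), g (ℓ + j) = (∏ j ∈ Finset.range k, g (ℓ + 1 + j)) * g ℓ := by
        rw [Finset.prod_range_succ']
        congr 1
        refine Finset.prod_congr rfl fun j _ => ?_
        congr 1
        omega
      rw [e1, e2, hF]
      ring
    rw [hunfold, hprod]
    calc (∑ pm ∈ parities, ∑ pn ∈ parities, debrisOut θ K t' s' k (ℓ + 1) ((α + pm) / 2) ((β + pn) / 2) (debrisChild θ K α β pm pn ζ))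
        ≤ ∑ pm ∈ parities, ∑ pn ∈ parities, F * W (ℓ + 1) ((α + pm) / 2) ((β + pn) / 2) (debrisChild θ K α β pm pn ζ) :=
          Finset.sum_le_sum fun pm hpm => Finset.sum_le_sum fun pn hpn => hchild pm hpm pn hpn
      _ = F * ∑ pm ∈ parities, ∑ pn ∈ parities, W (ℓ + 1) ((α + pm) / 2) ((β + pn) / 2) (debrisChild θ K α β pm pn ζ) := by
          rw [Finset.mul_sum]; refine Finset.sum_congr rfl fun pm _ => ?_; rw [Finset.mul_sum]
      _ ≤ F * (g ℓ * W ℓ α β ζ) := mul_le_mul_of_nonneg_left (hW ℓ α β ζ hζ) hF0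
      _ = F * g ℓ * W ℓ α β ζ := by ring

/-! ## 2. Constant gain: the rate form and the contraction («control») form -/

/-- Constant gain `r²` and constant output constant `C`: `debrisOut k ≤ C · (r²)^k · W`. -/
theorem debrisOut_le_of_lyapunov_rate (P : ℕ → ℝ → ℝ → CState → Prop) (W : ℕ → ℝ → ℝ → CState → ℝ) (r C : ℝ)
    (hC : 0 ≤ C) (hP : DebrisInvariant θ K P) (hW : OneStepLaw θ K P W (fun _ => r ^ 2))
    (hOut : OutputLaw θ K t' s' P W (fun _ => C)) :
    ∀ (k ℓ : ℕ) (α β : ℝ) (ζ : CState), P ℓ α β ζ →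
      debrisOut θ K t' s' k ℓ α β ζ ≤ C * (r ^ 2) ^ k * W ℓ α β ζ := by
  intro k ℓ α β ζ hζ
  have h := debrisOut_le_of_lyapunov θ K t' s' P W (fun _ => r ^ 2) (fun _ => C) (fun _ => sq_nonneg r) (fun _ => hC) hP hW hOut
    k ℓ α β ζ hζ
  simpa [Finset.prod_const, Finset.card_range] using h

/-- **The «control» form.**  If `W` is a LYAPUNOV functional of the debris dynamics on the invariant class `P` (children's total does not exceed
the parent's) then the lineage output is bounded by `C · W` UNIFORMLY IN THE AGE. -/
theorem debrisOut_le_of_lyapunov_contract (P : ℕ → ℝ → ℝ → CState → Prop) (W : ℕ → ℝ → ℝ → CState → ℝ) (C : ℝ)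
    (hC : 0 ≤ C) (hP : DebrisInvariant θ K P) (hW : OneStepLaw θ K P W (fun _ => 1))
    (hOut : OutputLaw θ K t' s' P W (fun _ => C)) :
    ∀ (k ℓ : ℕ) (α β : ℝ) (ζ : CState), P ℓ α β ζ → debrisOut θ K t' s' k ℓ α β ζ ≤ C * W ℓ α β ζ := by
  intro k ℓ α β ζ hζ
  have hW' : OneStepLaw θ K P W (fun _ => (1 : ℝ) ^ 2) := by simpa using hW
  have h := debrisOut_le_of_lyapunov_rate θ K t' s' P W 1 C hC hP hW' hOut k ℓ α β ζ hζ
  simpa using h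

/-! ## 3. Seeding: from the reduction to `DebrisTransfer` at every age `k ≥ 1` -/

/-- SEEDING of class `(α, β)` for inputs of type `t` in shell `s`: every windowed input's four first-generation debris children lie in `P` at
level `1`, and their total `W` is at most `B ×` the input's level-0 energy.  (`B` carries the Orr-type first-step amplification.) -/
def Seeding (α β : ℝ) (t : PType) (s : ℕ) (P : ℕ → ℝ → ℝ → CState → Prop) (W : ℕ → ℝ → ℝ → CState → ℝ) (B : ℝ) : Prop :=
  ∀ d : ℤ → Fin 2 → ℂ, SupportedInW s (alongCoord α β t) K d →
    (∀ pm ∈ parities, ∀ pn ∈ parities, P 1 ((α + pm) / 2) ((β + pn) / 2) (debrisChild θ K α β pm pn (inputState α β θ K t d))) ∧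
    (∑ pm ∈ parities, ∑ pn ∈ parities, W 1 ((α + pm) / 2) ((β + pn) / 2) (debrisChild θ K α β pm pn (inputState α β θ K t d)))
      ≤ B * cEnergy α β 0 K (inputState α β θ K t d)

/-- **(B2) from a rate-`r` Lyapunov law.**  Reduction + seeding ⇒ `DebrisTransfer α β θ K k t s t′ s′ (√(C·B)·r^(k-1))` for every age `k ≥ 1`. -/
theorem debrisTransfer_of_lyapunov_rate (P : ℕ → ℝ → ℝ → CState → Prop) (W : ℕ → ℝ → ℝ → CState → ℝ) (r C B : ℝ)
    (hr : 0 ≤ r) (hC : 0 ≤ C) (hB : 0 ≤ B) (hP : DebrisInvariant θ K P) (hW : OneStepLaw θ K P W (fun _ => r ^ 2))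
    (hOut : OutputLaw θ K t' s' P W (fun _ => C)) {α β : ℝ} {t : PType} {s : ℕ} (hS : Seeding θ K α β t s P W B) :
    ∀ k : ℕ, 1 ≤ k → DebrisTransfer α β θ K k t s t' s' (Real.sqrt (C * B) * r ^ (k - 1)) := by
  intro k hk d hd
  obtain ⟨k, rfl⟩ : ∃ j, k = j + 1 := ⟨k - 1, by omega⟩
  simp only [Nat.add_sub_cancel]
  obtain ⟨hPin, hWin⟩ := hS d hd
  set ζ0 : CState := inputState α β θ K t d with hζ0
  have hunfold : debrisOut θ K t' s' (k + 1) 0 α β ζ0 =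
      ∑ pm ∈ parities, ∑ pn ∈ parities, debrisOut θ K t' s' k 1 ((α + pm) / 2) ((β + pn) / 2) (debrisChild θ K α β pm pn ζ0) := by
    simp only [debrisOut, debrisChild]
  have hCr : 0 ≤ C * (r ^ 2) ^ k := mul_nonneg hC (pow_nonneg (sq_nonneg r) k)
  have hchild : ∀ pm ∈ parities, ∀ pn ∈ parities,
      debrisOut θ K t' s' k 1 ((α + pm) / 2) ((β + pn) / 2) (debrisChild θ K α β pm pn ζ0) ≤
        C * (r ^ 2) ^ k * W 1 ((α + pm) / 2) ((β + pn) / 2) (debrisChild θ K α β pm pn ζ0) := by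
    intro pm hpm pn hpn
    have h := debrisOut_le_of_lyapunov_rate θ K t' s' P W r C hC hP hW hOut k 1 _ _ _ (hPin pm hpm pn hpn)
    exact h
  have hsq : (Real.sqrt (C * B) * r ^ k) ^ 2 = C * (r ^ 2) ^ k * B := by
    rw [mul_pow, Real.sq_sqrt (mul_nonneg hC hB), ← pow_mul, mul_comm k 2, pow_mul]; ring
  rw [hunfold, hsq]
  calc (∑ pm ∈ parities, ∑ pn ∈ parities, debrisOut θ K t' s' k 1 ((α + pm) / 2) ((β + pn) / 2) (debrisChild θ K α β pm pn ζ0))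
      ≤ ∑ pm ∈ parities, ∑ pn ∈ parities, C * (r ^ 2) ^ k * W 1 ((α + pm) / 2) ((β + pn) / 2) (debrisChild θ K α β pm pn ζ0) :=
        Finset.sum_le_sum fun pm hpm => Finset.sum_le_sum fun pn hpn => hchild pm hpm pn hpn
    _ = C * (r ^ 2) ^ k * ∑ pm ∈ parities, ∑ pn ∈ parities, W 1 ((α + pm) / 2) ((β + pn) / 2) (debrisChild θ K α β pm pn ζ0) := by
        rw [Finset.mul_sum]; refine Finset.sum_congr rfl fun pm _ => ?_; rw [Finset.mul_sum]
    _ ≤ C * (r ^ 2) ^ k * (B * cEnergy α β 0 K ζ0) := mul_le_mul_of_nonneg_left hWin hCr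
    _ = C * (r ^ 2) ^ k * B * cEnergy α β 0 K ζ0 := by ring

/-- **(B2) in «control» form: ONE age-free constant.**  A Lyapunov functional on the reachable class + seeding ⇒
`∀ k ≥ 1, DebrisTransfer α β θ K k t s t′ s′ (√(C·B))` — the age-uniform booking `D k = D̄` of the renewal cone. -/
theorem debrisTransfer_of_lyapunov (P : ℕ → ℝ → ℝ → CState → Prop) (W : ℕ → ℝ → ℝ → CState → ℝ) (C B : ℝ)
    (hC : 0 ≤ C) (hB : 0 ≤ B) (hP : DebrisInvariant θ K P) (hW : OneStepLaw θ K P W (fun _ => 1))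
    (hOut : OutputLaw θ K t' s' P W (fun _ => C)) {α β : ℝ} {t : PType} {s : ℕ} (hS : Seeding θ K α β t s P W B) :
    ∀ k : ℕ, 1 ≤ k → DebrisTransfer α β θ K k t s t' s' (Real.sqrt (C * B)) := by
  intro k hk
  have hW' : OneStepLaw θ K P W (fun _ => (1 : ℝ) ^ 2) := by simpa using hW
  have h := debrisTransfer_of_lyapunov_rate θ K t' s' P W 1 C B zero_le_one hC hB hP hW' hOut hS k hk
  simpa using h

/-! ## 4. The positive-linear-system form (vector Lyapunov function, nonnegative gain matrix) -/

/-- Componentwise one-step law with an `m × m` gain matrix `A`: `Σ_children W⃗(child) ≤ A · W⃗(ζ)` on `P`. -/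
def OneStepLawVec {m : ℕ} (P : ℕ → ℝ → ℝ → CState → Prop) (Wv : ℕ → ℝ → ℝ → CState → Fin m → ℝ)
    (A : Matrix (Fin m) (Fin m) ℝ) : Prop :=
  ∀ ℓ α β ζ, P ℓ α β ζ → ∀ i : Fin m,
    (∑ pm ∈ parities, ∑ pn ∈ parities, Wv (ℓ + 1) ((α + pm) / 2) ((β + pn) / 2) (debrisChild θ K α β pm pn ζ) i) ≤
      (A.mulVec (Wv ℓ α β ζ)) i

/-- Output law with a row `c⃗`: `debrisOut₀ ≤ c⃗ ⬝ W⃗` on `P`. -/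
def OutputLawVec {m : ℕ} (P : ℕ → ℝ → ℝ → CState → Prop) (Wv : ℕ → ℝ → ℝ → CState → Fin m → ℝ) (c : Fin m → ℝ) : Prop :=
  ∀ ℓ α β ζ, P ℓ α β ζ → debrisOut θ K t' s' 0 ℓ α β ζ ≤ dotProduct c (Wv ℓ α β ζ)

/-- Rows of powers of an entrywise-nonnegative matrix applied to a nonnegative row stay nonnegative: `0 ≤ c⃗ ᵥ* A^k`. -/
theorem vecMul_pow_nonneg {m : ℕ} (A : Matrix (Fin m) (Fin m) ℝ) (hA : ∀ i j, 0 ≤ A i j) (c : Fin m → ℝ) (hc : ∀ i, 0 ≤ c i) :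
    ∀ (k : ℕ) (j : Fin m), 0 ≤ (Matrix.vecMul c (A ^ k)) j := by
  intro k
  induction k with
  | zero => intro j; simpa using hc j
  | succ k ih =>
    intro j
    rw [pow_succ, ← Matrix.vecMul_vecMul]
    simp only [Matrix.vecMul, dotProduct]
    exact Finset.sum_nonneg fun i _ => mul_nonneg (ih i) (hA i j)

/-- **Positive-system reduction.**  `debrisOut k ℓ ζ ≤ (c⃗ ᵥ* A^k) ⬝ W⃗ ℓ ζ` on `P`, for an entrywise-nonnegative gain matrix and output row. -/
theorem debrisOut_le_of_lyapunovVec {m : ℕ} (P : ℕ → ℝ → ℝ → CState → Prop) (Wv : ℕ → ℝ → ℝ → CState → Fin m → ℝ)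
    (A : Matrix (Fin m) (Fin m) ℝ) (c : Fin m → ℝ) (hA : ∀ i j, 0 ≤ A i j) (hc : ∀ i, 0 ≤ c i)
    (hP : DebrisInvariant θ K P) (hW : OneStepLawVec θ K P Wv A) (hOut : OutputLawVec θ K t' s' P Wv c) :
    ∀ (k ℓ : ℕ) (α β : ℝ) (ζ : CState), P ℓ α β ζ →
      debrisOut θ K t' s' k ℓ α β ζ ≤ dotProduct (Matrix.vecMul c (A ^ k)) (Wv ℓ α β ζ) := by
  intro k
  induction k with
  | zero =>
    intro ℓ α β ζ hζ
    simpa using hOut ℓ α β ζ hζ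
  | succ k ih =>
    intro ℓ α β ζ hζ
    have hunfold : debrisOut θ K t' s' (k + 1) ℓ α β ζ =
        ∑ pm ∈ parities, ∑ pn ∈ parities, debrisOut θ K t' s' k (ℓ + 1) ((α + pm) / 2) ((β + pn) / 2) (debrisChild θ K α β pm pn ζ) := by
      simp only [debrisOut, debrisChild]
    set v : Fin m → ℝ := Matrix.vecMul c (A ^ k) with hv
    have hv0 : ∀ j, 0 ≤ v j := vecMul_pow_nonneg A hA c hc k
    have hchild : ∀ pm ∈ parities, ∀ pn ∈ parities,
        debrisOut θ K t' s' k (ℓ + 1) ((α + pm) / 2) ((β + pn) / 2) (debrisChild θ K α β pm pn ζ) ≤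
          dotProduct v (Wv (ℓ + 1) ((α + pm) / 2) ((β + pn) / 2) (debrisChild θ K α β pm pn ζ)) := by
      intro pm hpm pn hpn
      exact ih (ℓ + 1) _ _ _ (hP ℓ α β ζ hζ pm hpm pn hpn)
    have hstep : Matrix.vecMul c (A ^ (k + 1)) = Matrix.vecMul v A := by
      rw [pow_succ, ← Matrix.vecMul_vecMul]
    rw [hunfold, hstep]
    calc (∑ pm ∈ parities, ∑ pn ∈ parities, debrisOut θ K t' s' k (ℓ + 1) ((α + pm) / 2) ((β + pn) / 2) (debrisChild θ K α β pm pn ζ))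
        ≤ ∑ pm ∈ parities, ∑ pn ∈ parities, dotProduct v (Wv (ℓ + 1) ((α + pm) / 2) ((β + pn) / 2) (debrisChild θ K α β pm pn ζ)) :=
          Finset.sum_le_sum fun pm hpm => Finset.sum_le_sum fun pn hpn => hchild pm hpm pn hpn
      _ = dotProduct v (∑ pm ∈ parities, ∑ pn ∈ parities, Wv (ℓ + 1) ((α + pm) / 2) ((β + pn) / 2) (debrisChild θ K α β pm pn ζ)) := by
          rw [dotProduct_sum]; refine Finset.sum_congr rfl fun pm _ => ?_; rw [dotProduct_sum]
      _ ≤ dotProduct v (A.mulVec (Wv ℓ α β ζ)) := by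
          simp only [dotProduct]
          refine Finset.sum_le_sum fun i _ => mul_le_mul_of_nonneg_left ?_ (hv0 i)
          have h := hW ℓ α β ζ hζ i
          simpa only [Finset.sum_apply] using h
      _ = dotProduct (Matrix.vecMul v A) (Wv ℓ α β ζ) := by
          rw [Matrix.dotProduct_mulVec]

end Reduction

/-! ## 5. Bookkeeping helpers for instantiating `P` (class range is preserved by the child classes) -/

theorem child_class_mem_Ico {α : ℝ} (hα : α ∈ Set.Ico (0 : ℝ) 1) {pm : ℤ} (hpm : pm ∈ parities) :
    (α + pm) / 2 ∈ Set.Ico (0 : ℝ) 1 := by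
  have hpm' : (pm : ℝ) = 0 ∨ (pm : ℝ) = 1 := by
    have : pm = 0 ∨ pm = 1 := by simpa [parities] using hpm
    rcases this with h | h <;> simp [h]
  obtain ⟨h0, h1⟩ := hα
  constructor <;> rcases hpm' with h | h <;> rw [h] <;> linarith


/-! ## 6. The AGGREGATE («generation») form — the weakest law the probe supports

Node by node the level energy is NOT a Lyapunov functional on all reachable states (kit j333310: per-node gains up to ×6 at negligible nodes),
but the TOTAL energy of a whole debris generation is non-increasing from age 2 on (sup over inputs ≤ 1.000, K = 48) after an early transient.
The generation functional `genW W k` (sum of `W` over the depth-`k` debris descendants) turns this into a typed hypothesis, and a node-wise output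
law on an invariant class still converts it into `DebrisTransfer` from age `k₀` on with ONE constant. -/

section Generation

variable (θ : ℝ) (K : ℕ) (t' : PType) (s' : ℕ)

/-- The generation functional: `genW W k ℓ α β ζ` = the sum of `W` over the debris descendants of `ζ` at depth `k` (depth 0 = `ζ` itself at
level `ℓ`; depth `k+1` = the four debris children one level down, depth `k` below each). -/
def genW (W : ℕ → ℝ → ℝ → CState → ℝ) : ℕ → ℕ → ℝ → ℝ → CState → ℝ
  | 0, ℓ, α, β, ζ => W ℓ α β ζ
  | k + 1, ℓ, α, β, ζ => ∑ pm ∈ parities, ∑ pn ∈ parities, genW W k (ℓ + 1) ((α + pm) / 2) ((β + pn) / 2) (debrisChild θ K α β pm pn ζ)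

/-- Depth-`k` descendants of a state in an invariant class stay in the class, so a node-wise law on `P` applies to every node of the generation:
**node-wise output law ⇒ `debrisOut k ≤ C · genW W k`** (the output of the age-`k` generation is controlled by that generation's total `W`). -/
theorem debrisOut_le_genW (P : ℕ → ℝ → ℝ → CState → Prop) (W : ℕ → ℝ → ℝ → CState → ℝ) (C : ℝ) (hC : 0 ≤ C)
    (hP : DebrisInvariant θ K P) (hOut : OutputLaw θ K t' s' P W (fun _ => C)) :
    ∀ (k ℓ : ℕ) (α β : ℝ) (ζ : CState), P ℓ α β ζ → debrisOut θ K t' s' k ℓ α β ζ ≤ C * genW θ K W k ℓ α β ζ := by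
  intro k
  induction k with
  | zero =>
    intro ℓ α β ζ hζ
    simpa [genW] using hOut ℓ α β ζ hζ
  | succ k ih =>
    intro ℓ α β ζ hζ
    have hunfold : debrisOut θ K t' s' (k + 1) ℓ α β ζ =
        ∑ pm ∈ parities, ∑ pn ∈ parities, debrisOut θ K t' s' k (ℓ + 1) ((α + pm) / 2) ((β + pn) / 2) (debrisChild θ K α β pm pn ζ) := by
      simp only [debrisOut, debrisChild]
    rw [hunfold, genW, Finset.mul_sum]
    refine Finset.sum_le_sum fun pm hpm => ?_
    rw [Finset.mul_sum]
    exact Finset.sum_le_sum fun pn hpn => ih (ℓ + 1) _ _ _ (hP ℓ α β ζ hζ pm hpm pn hpn)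

/-- `genW` of a nonnegative functional is nonnegative. -/
theorem genW_nonneg (W : ℕ → ℝ → ℝ → CState → ℝ) (hW : ∀ ℓ α β ζ, 0 ≤ W ℓ α β ζ) :
    ∀ (k ℓ : ℕ) (α β : ℝ) (ζ : CState), 0 ≤ genW θ K W k ℓ α β ζ := by
  intro k
  induction k with
  | zero => intro ℓ α β ζ; simpa [genW] using hW ℓ α β ζ
  | succ k ih =>
    intro ℓ α β ζ
    simp only [genW]
    exact Finset.sum_nonneg fun pm _ => Finset.sum_nonneg fun pn _ => ih _ _ _ _

/-- A node-wise one-step law implies the generation law: `genW W (k+1) ≤ g · genW W k` on `P` — so §1–§2 are the special case of §6 in which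
flatness is proved node by node. -/
theorem genW_succ_le_of_oneStepLaw (P : ℕ → ℝ → ℝ → CState → Prop) (W : ℕ → ℝ → ℝ → CState → ℝ) (g : ℝ) (hg : 0 ≤ g)
    (hP : DebrisInvariant θ K P) (hW : OneStepLaw θ K P W (fun _ => g)) :
    ∀ (k ℓ : ℕ) (α β : ℝ) (ζ : CState), P ℓ α β ζ → genW θ K W (k + 1) ℓ α β ζ ≤ g * genW θ K W k ℓ α β ζ := by
  intro k
  induction k with
  | zero =>
    intro ℓ α β ζ hζ
    simpa [genW] using hW ℓ α β ζ hζ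
  | succ k ih =>
    intro ℓ α β ζ hζ
    have h1 : genW θ K W (k + 1 + 1) ℓ α β ζ =
        ∑ pm ∈ parities, ∑ pn ∈ parities, genW θ K W (k + 1) (ℓ + 1) ((α + pm) / 2) ((β + pn) / 2) (debrisChild θ K α β pm pn ζ) := by
      rw [genW]
    have h2 : genW θ K W (k + 1) ℓ α β ζ =
        ∑ pm ∈ parities, ∑ pn ∈ parities, genW θ K W k (ℓ + 1) ((α + pm) / 2) ((β + pn) / 2) (debrisChild θ K α β pm pn ζ) := by
      rw [genW]
    rw [h1, h2, Finset.mul_sum]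
    refine Finset.sum_le_sum fun pm hpm => ?_
    rw [Finset.mul_sum]
    exact Finset.sum_le_sum fun pn hpn => ih (ℓ + 1) _ _ _ (hP ℓ α β ζ hζ pm hpm pn hpn)

/-- **AGGREGATE FLATNESS from depth `k₀`** for the root `(ℓ, α, β, ζ)`: every later generation carries at most `Λ ×` the depth-`k₀` generation's
total `W`.  (Probe, W = level energy, roots = windowed inputs: `Λ = 1` from `k₀ = 2` at K = 48 in all 42 cases; the frozen core is carried
isometrically, so the ratio tends to 1 from below.) -/
def GenFlat (W : ℕ → ℝ → ℝ → CState → ℝ) (Λ : ℝ) (k₀ ℓ : ℕ) (α β : ℝ) (ζ : CState) : Prop :=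
  ∀ k, k₀ ≤ k → genW θ K W k ℓ α β ζ ≤ Λ * genW θ K W k₀ ℓ α β ζ

/-- **Depth-`k₀` seeding** of the input cell `(t, s)`: the root state lies in `P` and the depth-`k₀` debris generation of every windowed input
carries total `W` at most `B ×` the input energy (an age-`k₀` quantity: for small `k₀` a finite, certifiable computation per truncation). -/
def GenSeeding (α β : ℝ) (t : PType) (s : ℕ) (P : ℕ → ℝ → ℝ → CState → Prop) (W : ℕ → ℝ → ℝ → CState → ℝ) (B : ℝ) (k₀ : ℕ) : Prop :=
  ∀ d : ℤ → Fin 2 → ℂ, SupportedInW s (alongCoord α β t) K d →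
    P 0 α β (inputState α β θ K t d) ∧ genW θ K W k₀ 0 α β (inputState α β θ K t d) ≤ B * cEnergy α β 0 K (inputState α β θ K t d)

/-- **(B2) from aggregate flatness.**  Node-wise output law on an invariant class containing the inputs + flatness of the generations from depth
`k₀` with factor `Λ` + depth-`k₀` seeding `B` ⇒ `DebrisTransfer α β θ K k t s t′ s′ (√(C·Λ·B))` for EVERY age `k ≥ k₀` — one age-free constant;
the finitely many younger ages `k < k₀` are booked by their own (measured / certified) entries. -/
theorem debrisTransfer_of_genFlat (P : ℕ → ℝ → ℝ → CState → Prop) (W : ℕ → ℝ → ℝ → CState → ℝ) (C Λ B : ℝ) (k₀ : ℕ)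
    (hC : 0 ≤ C) (hΛ : 0 ≤ Λ) (hB : 0 ≤ B) (hP : DebrisInvariant θ K P) (hOut : OutputLaw θ K t' s' P W (fun _ => C))
    {α β : ℝ} {t : PType} {s : ℕ} (hS : GenSeeding θ K α β t s P W B k₀)
    (hF : ∀ d : ℤ → Fin 2 → ℂ, SupportedInW s (alongCoord α β t) K d → GenFlat θ K W Λ k₀ 0 α β (inputState α β θ K t d)) :
    ∀ k : ℕ, k₀ ≤ k → DebrisTransfer α β θ K k t s t' s' (Real.sqrt (C * Λ * B)) := by
  intro k hk d hd
  obtain ⟨hPin, hseed⟩ := hS d hd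
  have hE0 : 0 ≤ cEnergy α β 0 K (inputState α β θ K t d) := by
    unfold cEnergy
    exact Finset.sum_nonneg fun m _ => Finset.sum_nonneg fun n _ => by positivity
  have h1 := debrisOut_le_genW θ K t' s' P W C hC hP hOut k 0 α β _ hPin
  have h2 := hF d hd k hk
  rw [Real.sq_sqrt (by positivity)]
  calc debrisOut θ K t' s' k 0 α β (inputState α β θ K t d)
      ≤ C * genW θ K W k 0 α β (inputState α β θ K t d) := h1
    _ ≤ C * (Λ * genW θ K W k₀ 0 α β (inputState α β θ K t d)) := mul_le_mul_of_nonneg_left h2 hC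
    _ ≤ C * (Λ * (B * cEnergy α β 0 K (inputState α β θ K t d))) :=
        mul_le_mul_of_nonneg_left (mul_le_mul_of_nonneg_left hseed hΛ) hC
    _ = C * Λ * B * cEnergy α β 0 K (inputState α β θ K t d) := by ring

end Generation

end Summit.AnomalousDissipation.AnomalousDissipation.Cruxes.K1LocalisedCascade.K2AgeLawControl
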